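import Summits.QuantumFields.YangMills.Theorems.BalabanUVNodesN11NoExpansionZetaSpecSucc
import Summits.QuantumFields.YangMills.Theorems.BalabanUVNodesN11TkBranchLinearLocal
import Summits.QuantumFields.YangMills.Theorems.BalabanUVNodesN11NoExpansionAtRecord13CoP
import Literature.MathematicalPhysics.QuantumFieldTheory.Balaban1983to89.Node00.Record12LocalLawsTwoScale
import Literature.MathematicalPhysics.QuantumFieldTheory.Balaban1983to89.Node00.LargeFieldBackgroundCoPOfRecordFacesB

/-!
# DAG node N11 — THE NO-EXPANSION DIAGONAL OF (S1ᵀ)₁₃CoP IS REACHABLE UNDER GENERATION-WISE PINS: along the ALL-LARGE-FIELD HISTORY (`Ω_j = ∅` for every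
# `j ≤ k+1`) the 𝐓-image §2-form clause at level `k+1` HOLDS at the v1.5 `CoP` record as soon as `ρ_k`'s slot has its §2 identity at the previous all-large
# sequence and the residual's generation-`k` factor is PINNED to def-T's level-`k` resummed step weight on the scale-`k` averaging graph —
# `ζ0_k(T)(V_k, V_{k+1}) := w_k(s′)(V_k, V̄_k)` (old factors agree by LINEARITY and SCALE-LOCALITY of 11a's branch operators, the operands by the term-free action)

Cell `pub-ymgap`, YM-PLAN Track A (HUMAN RULING D-0062), seat `pub-ymgap-dag-n11-d` (g7; R134 fan-out seat N11 [B14], strategy s2), route `BalabanUVNodes`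
rev 21, item K1⁵ `StabilityBAtRecordR13SepCoP` = stmt-QuantumFields-20294 (helper, count-neutral).  [III] = [Balaban1988Convergent].  Assembles this seat's
`BalabanUVNodesN11NoExpansionZetaSpecSucc` (the level-(k+1) sufficiency modulo old-factor agreement), `BalabanUVNodesN11TkBranchLinearLocal` ((L) + (SL) of 11a's
`𝐓_k(s,S)`), `BalabanUVNodesN11NoExpansionTermFree` (p495297: the (2.23) action along the all-large-field history is the bare Wilson action for EVERY term
witness), `…ZetaSpecAtCoP` ∕ `…NoExpansionAtRecord13CoP` (def-R's support-edition background reads the fine field along that history, no class hypothesis).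

WHY THIS FILE.  After F7 the first (S1ᵀ) conjunct at the all-large-field sequence of length 1 holds under the generation-0 pin `ζ0_0(T) := w_0(s′)(U, Ū)`
(p523822).  One level up the same bookkeeping closes: along the history with NO small-field region at any scale (i) the `{S_j}`-index of the old sequence is the
all-empty branch alone (Λ_j = Ω_j = ∅); (ii) BOTH operands — `e^{A_{k+1}(s′)}` at the new background `U_{k+1}(s′)(𝐖) = 𝐖 0` and `e^{A_k(init s′)}` at the old
one — are `e^{−g₀⁻²A(𝐖 0) − E}` (term-free action, support-edition background reads the fine field at every length), so they differ by the constant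
`κ = e^{E_k − E_{k+1}}` and read scale `0` only; (iii) 11a's old branch operator `𝐓_k(init s′, ∅)` is linear (L) and, the residual being LOCAL (12b's
`LocalLaws`: `ζ0_j` reads scale `j`) with the Gaussian placeholders `quad_j(∅) = 0`, `k`-local (SL) — so «the old factors agree»; (iv) the generation-`k`
factor of 12a″'s weights is `ζ0_k(T)·e^{−½quad_k(∅)} = ζ0_k(T)`.  Hence by `slotsT_succ_ae_eq_sect2Slot_of_zetaSpecAt` the clause holds with `c = κ = 1`,
i.e. `E_{k+1}(s′) := E_k(init s′)`, as soon as `ζ0_k(T)(U, V′) = w_k(s′)(U, Ū)`: THE GENERATION-`k` PIN READS THE LEVEL-`k` STEP WEIGHT ON THE SCALE-`k`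
GRAPH — the same shape at every generation, compatible with 12b's locality law (it reads the scale-`k` variables only).  With the zero branch of `SLaw` at
`init s′` propagating to the zero branch at `s′`, the whole dichotomy clause follows from `SLaw₁₃CoP θ p k`.

WHAT THIS FILE PROVES (0 `sorry`, 0 `def`, standard axioms; `N`-generic; `θ`, run `p`, `k < K`).  §1 `init_allLarge`, `admSOfRecord_init_eq_of_allLarge`
(the old index is `{∅}`), `UbgOfRecord₁₃CoP_eq_of_allLarge` (def-R's support-edition background reads `𝐖 0` at EVERY length along the history, EVERY `𝐖`).
§2 `sect2Operand_CoP_eq_of_allLarge` (both operands in closed form), `sect2Operand_succ_eq_const_mul_of_allLarge` (`Φ′ = e^{E_k−E_{k+1}}·Φ`), `sect2Operand_local_of_allLarge`.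
§3 `WtOfRecord₁₃P_ζ_local`, `WtOfRecord₁₃P_w_empty_eq_one` (`quad_j(∅) = 0`), ★ `oldFactors_agree_CoP_of_allLarge` ((3.24) at the `CoP` record along the history).
§4 ★★ `hasSect2FormAtZ_clause_succ_CoP_of_allLarge_pin` (THE THEOREM: `SLaw₁₃CoP θ p k` + the generation-`k` pin + `LocalLaws` + `quad_j(∅) = 0` + unity of
def-T's `ζ` + displayed measurability ∕ bound of the old branch and joint measurability of `w_k(s′)` ⇒ the (S1ᵀ)₁₃CoP,ₖ clause at the all-large-field sequence of
length `k+1`, with `E_{k+1}(s′) = E_k(init s′)`, for EVERY term-value witness).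

EDITION (Stage-2 train, WORKPLAN-IIIB (iii-b), director-ym №343 (D5)∕(D6), row TRAIN-N11, seat dag-n11-d g41): the level-`1` branch of `UbgOfRecord₁₃CoP_eq_of_allLarge` is
re-proved SEAM-ROBUSTLY (`apply_rules` over node00-def-R's `UbgMSCoPOfRecord_one_of_Omega_empty` and its S2c print-datum twin `UbgMSCoPOfRecordB_one_of_Omega_empty`): statement
byte-identical; it elaborates BEFORE and AFTER the `Record13CoP` seam edit (FLAG №16 ∕ LOCATE-HSEAM 5d3298b8d191f169).

HONEST FRAMING.  Count-neutral kernel bookkeeping on the tree's OWN objects; the SUFFICIENT half of (S1ᵀ)₁₃CoP at the ONE new sequence per level that carries no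
expansion — the no-expansion DIAGONAL —, under a DISPLAYED pin on the witness's residual at generation `k` (K0a's pen; the pin reads the run, `θ.Zt K` does
not — located remark of p522000).  NOT `TLaw₁₃CoP θ p k` (every other new sequence is [III] §3 + Thm 2 proper), NOT a witness, nothing of Bałaban's asserted.
N11 NOT discharged; counts unmoved (typed 28∕28 · discharged 5∕28).  One finite four-torus programme at fixed `ε = L^{−K}`; NOT ℝ⁴, NOT OS, NOT a mass gap,
NOT Clay.  Sources: [III] (2.1)–(2.2) pp. 254–255, (2.12)–(2.13) pp. 256–257, (2.18) p. 257, (2.20)–(2.23) p. 258, (3.1) p. 264, (3.16) p. 268, (3.24)–(3.25)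
p. 270, Theorem p. 245, Thm 1 p. 262.
-/

noncomputable section

open MeasureTheory
open scoped BigOperators Matrix.Norms.L2Operator

namespace Summit.QuantumFields.YangMills.Theorems.BalabanUVNodesN11NoExpansionAllLargeCoP

open Literature.MathematicalPhysics.QuantumFieldTheory.Balaban1983to89 T4Continuum Node00 Node00.Tk DagBinding
open B15DeterminingSets
open BalabanUVNodesN11NoExpansionTermFree (action23_of_forall_Omega_empty)
open BalabanUVNodesN11NoExpansionZetaSpecAtCoP (WtOfRecord₁₃P_ζ_zero_univ)
open BalabanUVNodesN11NoExpansionAtRecord13CoP (UbgOfRecord₁₃CoP_succ_eq_init_of_Omega_empty)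
open BalabanUVNodesN11TkBranchLinearLocal (tkBranchOfRecord_const_mul tkBranchOfRecord_pairCfgAt_eq_baseCfg)
open BalabanUVNodesN11NoExpansionZetaSpecSucc (slotsT_succ_ae_eq_sect2Slot_of_zetaSpecAt noExpIntegrandAt_eq_zetaFactor_mul)

variable {F : T4Family} {N : ℕ} [NeZero N]

/-! ## §1. Along the all-large-field history: the old sequence, the old index, the support-edition background at every length -/

section History

variable (θ : Stage13Params F N) (p : B12.RunParams)

/-- `init` of an all-large-field history is all-large-field. [cite: Balaban1988Convergent, (2.1) p.254 (bookkeeping)] -/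
theorem init_allLarge {k : ℕ} (s : SeqOfRecord F θ.ν θ.τ9.M (gOfRecord₁₃ F N θ p) p.K (k + 1))
    (hall : ∀ j, 1 ≤ j → j ≤ k + 1 → s.Ω j = ∅) : ∀ j, 1 ≤ j → j ≤ k → s.init.Ω j = ∅ :=
  fun j h1 hj => by rw [seq_init_Ω_of_le s hj]; exact hall j h1 (Nat.le_succ_of_le hj)

/-- **ALONG THE ALL-LARGE-FIELD HISTORY THE OLD `{S_j}`-INDEX IS THE ALL-EMPTY BRANCH ALONE** (`S_j ⊂ Ω_j ∩ Λ_jᶜ = ∅`). [cite: Balaban1988Convergent, (2.1) p.254] -/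
theorem admSOfRecord_init_eq_of_allLarge {k : ℕ} (s : SeqOfRecord F θ.ν θ.τ9.M (gOfRecord₁₃ F N θ p) p.K (k + 1))
    (hall : ∀ j, 1 ≤ j → j ≤ k + 1 → s.Ω j = ∅) :
    admSOfRecord F θ.ν θ.τ9.M (gOfRecord₁₃ F N θ p) p.K k s.init = {fun _ => (∅ : Set (Site (F.P p.K) 0))} :=
  admSOfRecord_of_eq F θ.ν θ.τ9.M _ p.K k s.init fun j h1 hj => by
    rw [init_allLarge θ p s hall j h1 hj, seq_Λ_eq_empty_of_Ω_eq_empty s.init (init_allLarge θ p s hall j h1 hj)]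

/-- **def-R's SUPPORT-EDITION BACKGROUND OF RECORD READS THE FINE FIELD AT EVERY LENGTH ALONG THE ALL-LARGE-FIELD HISTORY, FOR EVERY RETAINED CONFIGURATION**
(`U_n(s)(𝐖) = 𝐖 0`: level 0 by the pin, level 1 by `UbgMSCoPOfRecord_one_of_Omega_empty` — no class hypothesis —, level `n+1 ≥ 2` unchanged from level `n`).
[cite: Balaban1988Convergent, (2.12)–(2.13) pp.256–257, Thm 1 p.262, p.248 L17–20] -/
theorem UbgOfRecord₁₃CoP_eq_of_allLarge :
    ∀ (n : ℕ) (s : SeqOfRecord F θ.ν θ.τ9.M (gOfRecord₁₃ F N θ p) p.K n), (∀ j, 1 ≤ j → j ≤ n → s.Ω j = ∅) →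
      ∀ W : MSField (F.P p.K) (SU N), UbgOfRecord₁₃CoP F N θ p n s W = W 0
  | 0, _, _, _ => rfl
  | n + 1, s, hall, W => by
      rcases Nat.eq_zero_or_pos n with rfl | hn
      · -- Stage-2 SEAM-ROBUST (WORKPLAN-IIIB, director-ym №343): the (b) face or its print-datum twin (node00-def-R's S2c), whichever the seam state needs.
        have h1 : s.Ω 1 = ∅ := hall 1 le_rfl le_rfl
        apply_rules only [h1, UbgMSCoPOfRecord_one_of_Omega_empty, UbgMSCoPOfRecordB_one_of_Omega_empty]
      · rw [UbgOfRecord₁₃CoP_succ_eq_init_of_Omega_empty θ p hn s (hall (n + 1) (by omega) le_rfl)]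
        exact UbgOfRecord₁₃CoP_eq_of_allLarge n s.init (init_allLarge θ p s hall) W

end History

/-! ## §2. The two operands along the all-large-field history: closed form, constant ratio, scale-0 locality -/

section Operands

variable (θ : Stage13Params F N) (p : B12.RunParams)

/-- **THE §2 OPERAND AT THE `CoP` BACKGROUND ALONG THE ALL-LARGE-FIELD HISTORY, CLOSED FORM**: `e^{A_n(s)}(ω) = exp(−g₀⁻²A((ω 0).1) − E_n)` for EVERY term-value
witness and EVERY fluctuation argument (term-free action, p495297; background `= 𝐖 0`, §1; `M ≥ 1`). [cite: Balaban1988Convergent, (2.23) p.258, (2.12) p.256, Thm 1 p.262] -/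
theorem sect2Operand_CoP_eq_of_allLarge (hM : 1 ≤ θ.τ9.M) {n : ℕ} (s : SeqOfRecord F θ.ν θ.τ9.M (gOfRecord₁₃ F N θ p) p.K n)
    (hall : ∀ j, 1 ≤ j → j ≤ n → s.Ω j = ∅) (t : Sect2.TermValues (F.P p.K) (MatA N) (FluctV N) θ.τ9.M) (Ek : ℝ)
    (a : SFluct (F.P p.K) (FluctV N)) (ω : MultiCfg (F.P p.K) (SU N) (FluctV N)) :
    sect2Operand F N (FluctV N) p.K (settingOfRecord₁₃ F N θ p) (θ.Rz p.K) s t Ek (UbgOfRecord₁₃CoP F N θ p n s) a (fun j => (ω j).1) =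
      Real.exp (-(1 / (gOfRecord₁₃ F N θ p 0) ^ 2 * wilsonAction4 (ω 0).1) - Ek) := by
  show Real.exp _ = _
  rw [UbgOfRecord₁₃CoP_eq_of_allLarge θ p n s hall, action23_of_forall_Omega_empty (settingOfRecord₁₃ F N θ p) (θ.Rz p.K) hM s hall t a Ek,
    settingOfRecord₁₃_flow_g]

/-- **THE NEW OPERAND IS A CONSTANT MULTIPLE OF THE OLD ONE** along the all-large-field history: `e^{A_{k+1}(s′)} = e^{E_k − E_{k+1}}·e^{A_k(init s′)}` as functions
on the all-scales configuration, for ANY two term-value witnesses and branches. [cite: Balaban1988Convergent, (2.23)–(2.24) p.258, (3.24) p.270] -/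
theorem sect2Operand_succ_eq_const_mul_of_allLarge (hM : 1 ≤ θ.τ9.M) {k : ℕ} (s : SeqOfRecord F θ.ν θ.τ9.M (gOfRecord₁₃ F N θ p) p.K (k + 1))
    (hall : ∀ j, 1 ≤ j → j ≤ k + 1 → s.Ω j = ∅) (t t' : Sect2.TermValues (F.P p.K) (MatA N) (FluctV N) θ.τ9.M) (Ek Ek' : ℝ)
    (S S' : ℕ → Set (Site (F.P p.K) 0)) :
    (fun ω : MultiCfg (F.P p.K) (SU N) (FluctV N) =>
        sect2Operand F N (FluctV N) p.K (settingOfRecord₁₃ F N θ p) (θ.Rz p.K) s t' Ek' (UbgOfRecord₁₃CoP F N θ p (k + 1) s)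
          (S', fun j => (ω j).2) (fun j => (ω j).1)) =
      fun ω => Real.exp (Ek - Ek') *
        sect2Operand F N (FluctV N) p.K (settingOfRecord₁₃ F N θ p) (θ.Rz p.K) s.init t Ek (UbgOfRecord₁₃CoP F N θ p k s.init)
          (S, fun j => (ω j).2) (fun j => (ω j).1) := by
  funext ω
  rw [sect2Operand_CoP_eq_of_allLarge θ p hM s hall, sect2Operand_CoP_eq_of_allLarge θ p hM s.init (init_allLarge θ p s hall), ← Real.exp_add]
  congr 1
  ring

/-- **THE OLD OPERAND READS SCALE 0 ONLY** along the all-large-field history (hence it is `k`-local). [cite: Balaban1988Convergent, (2.23) p.258 (bookkeeping)] -/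
theorem sect2Operand_local_of_allLarge (hM : 1 ≤ θ.τ9.M) {n : ℕ} (s : SeqOfRecord F θ.ν θ.τ9.M (gOfRecord₁₃ F N θ p) p.K n)
    (hall : ∀ j, 1 ≤ j → j ≤ n → s.Ω j = ∅) (t : Sect2.TermValues (F.P p.K) (MatA N) (FluctV N) θ.τ9.M) (Ek : ℝ)
    (S : ℕ → Set (Site (F.P p.K) 0)) {k : ℕ} (ω ω' : MultiCfg (F.P p.K) (SU N) (FluctV N)) (h : ∀ i, i ≤ k → ω i = ω' i) :
    sect2Operand F N (FluctV N) p.K (settingOfRecord₁₃ F N θ p) (θ.Rz p.K) s t Ek (UbgOfRecord₁₃CoP F N θ p n s) (S, fun j => (ω j).2) (fun j => (ω j).1) =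
      sect2Operand F N (FluctV N) p.K (settingOfRecord₁₃ F N θ p) (θ.Rz p.K) s t Ek (UbgOfRecord₁₃CoP F N θ p n s) (S, fun j => (ω' j).2) (fun j => (ω' j).1) := by
  rw [sect2Operand_CoP_eq_of_allLarge θ p hM s hall, sect2Operand_CoP_eq_of_allLarge θ p hM s hall, h 0 (Nat.zero_le k)]

end Operands

/-! ## §3. 12a″'s weights along the history: local `ζ`, trivial empty-region A-weights; hence «the old factors agree» at the `CoP` record -/

section OldFactors

variable (θ : Stage13Params F N) (p : B12.RunParams)

/-- Under 12b's locality law (two-scale since W2∕T1′ 2026-08-29: `ζ0 j` reads scales `j` and `(j+1).1`, [III] (3.1)–(3.4)) the `ζ`-field of 12a″'s weights of record at generation `j` is `k`-local for `j < k` (the `j = k` case is not a theorem under the two-scale row).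
[cite: Balaban1988Convergent, (3.2)–(3.3) p.265, p.267, (1.11) p.248] -/
theorem WtOfRecord₁₃P_ζ_local (hloc : (θ.Zt p.K).LocalLaws) {k j : ℕ} (hj : j < k) (Y : Set (Site (F.P p.K) 0))
    (ω ω' : MultiCfg (F.P p.K) (SU N) (FluctV N)) (h : ∀ i, i ≤ k → ω i = ω' i) :
    (WtOfRecord₁₃P F N θ p).ζ j Y ω = (WtOfRecord₁₃P F N θ p).ζ j Y ω' :=
  -- W2∕T2′ of the FLAG №1 R2b cure: restated at `j < k`; proved through the funnel
  hloc.localLaws₂.zeta0_local_lt hj Y ω ω' h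

/-- With the Gaussian placeholders `quad_j(∅) = 0` the empty-region A-weight of 12a″'s weights is `1` (`χ(∅,∅) = 1`). [cite: Balaban1988Convergent, (2.21)–(2.22) p.258, (3.21) p.269] -/
theorem WtOfRecord₁₃P_w_empty_eq_one (hq : ∀ (j : ℕ) (ω : MultiCfg (F.P p.K) (SU N) (FluctV N)), (θ.Zt p.K).quad j ∅ ω = 0) (j : ℕ)
    (ω : MultiCfg (F.P p.K) (SU N) (FluctV N)) : (WtOfRecord₁₃P F N θ p).w j ∅ ∅ ∅ ω = 1 := by
  show chiAW F N (FluctV N) θ.ν θ.A₁ p (gOfRecord₁₃ F N θ p) j ∅ ∅ ω * Real.exp (-(1 / 2 : ℝ) * (θ.Zt p.K).quad j ∅ ω) = 1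
  rw [chiAW_empty_empty, hq, mul_zero, Real.exp_zero, one_mul]

/-- **★ «THE OLD FACTORS AGREE» AT THE `CoP` RECORD ALONG THE ALL-LARGE-FIELD HISTORY** ((3.24)): for the all-empty old branch, the old branch operator of the
new operand at the two-scale configuration equals `e^{E_k − E_{k+1}}` times the old branch operator of the old operand at the base configuration —
linearity (L) for the constant, scale-locality (SL) for the configuration (12b's locality law; `quad_j(∅) = 0`; the operands read scale `0`), `M ≥ 1`.
[cite: Balaban1988Convergent, (3.24) p.270, (2.20)–(2.23) p.258] -/
theorem oldFactors_agree_CoP_of_allLarge (hM : 1 ≤ θ.τ9.M) (hloc : (θ.Zt p.K).LocalLaws)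
    (hq : ∀ (j : ℕ) (ω : MultiCfg (F.P p.K) (SU N) (FluctV N)), (θ.Zt p.K).quad j ∅ ω = 0)
    {k : ℕ} (s : SeqOfRecord F θ.ν θ.τ9.M (gOfRecord₁₃ F N θ p) p.K (k + 1)) (hall : ∀ j, 1 ≤ j → j ≤ k + 1 → s.Ω j = ∅)
    (t t' : Sect2.TermValues (F.P p.K) (MatA N) (FluctV N) θ.τ9.M) (Ek Ek' : ℝ)
    (V' : GaugeField (F.P p.K) (k + 1) (SU N)) (U₀ : GaugeField (F.P p.K) k (SU N)) :
    tkBranchOfRecord F N (FluctV N) θ.ν θ.τ9.M _ p.K (WtOfRecord₁₃P F N θ p) s.init (fun _ => ∅) k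
        (fun ω => sect2Operand F N (FluctV N) p.K (settingOfRecord₁₃ F N θ p) (θ.Rz p.K) s t' Ek' (UbgOfRecord₁₃CoP F N θ p (k + 1) s)
          ((fun _ => ∅ : ℕ → Set (Site (F.P p.K) 0)), fun j => (ω j).2) (fun j => (ω j).1))
        (pairCfgAt (V := FluctV N) k V' U₀) =
      Real.exp (Ek - Ek') * tkBranchOfRecord F N (FluctV N) θ.ν θ.τ9.M _ p.K (WtOfRecord₁₃P F N θ p) s.init (fun _ => ∅) k
        (fun ω => sect2Operand F N (FluctV N) p.K (settingOfRecord₁₃ F N θ p) (θ.Rz p.K) s.init t Ek (UbgOfRecord₁₃CoP F N θ p k s.init)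
          ((fun _ => ∅ : ℕ → Set (Site (F.P p.K) 0)), fun j => (ω j).2) (fun j => (ω j).1))
        (baseCfg (V := FluctV N) k U₀) := by
  have hinit := init_allLarge θ p s hall
  rw [sect2Operand_succ_eq_const_mul_of_allLarge θ p hM s hall t t' Ek Ek' (fun _ => ∅) (fun _ => ∅), tkBranchOfRecord_const_mul]
  congr 1
  refine tkBranchOfRecord_pairCfgAt_eq_baseCfg θ.ν θ.τ9.M _ p.K (WtOfRecord₁₃P F N θ p) s.init (fun _ => ∅) ?_ ?_ ?_ V' U₀
  · intro j hj ω ω' h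
    exact hloc.localLaws₂.zeta0_local_lt hj _ ω ω' h  -- v1.1 (T0′ of the FLAG №1 R2b cure): through the funnel, not the `j ≤ k` lemma above
  · intro j hj ω ω' _
    have hΩ : s.init.Ω (j + 1) = ∅ := hinit (j + 1) (by omega) (by omega)
    have hΛ : s.init.Λ (j + 1) = ∅ := seq_Λ_eq_empty_of_Ω_eq_empty s.init hΩ
    rw [hΛ, hΩ, Set.inter_empty, WtOfRecord₁₃P_w_empty_eq_one θ p hq, WtOfRecord₁₃P_w_empty_eq_one θ p hq]
  · intro ω ω' h
    exact sect2Operand_local_of_allLarge θ p hM s.init hinit t Ek (fun _ => ∅) ω ω' h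

end OldFactors

/-! ## §4. ★★ THE THEOREM: the (S1ᵀ)₁₃CoP,ₖ clause at the all-large-field sequence of length k+1 from `SLaw₁₃CoP θ p k` and the generation-`k` pin -/

section Main

variable (θ : Stage13Params F N) (p : B12.RunParams)

/-- **★★ THE NO-EXPANSION DIAGONAL IS REACHABLE UNDER GENERATION-WISE PINS.**  Let `s′` be the all-large-field new sequence of length `k+1` (`Ω_j(s′) = ∅` for every
`1 ≤ j ≤ k+1`; `k < K`, `1 ≤ M`), and suppose `SLaw₁₃CoP θ p k` holds (the §2 form of `ρ_k` at the `CoP` objects — all of it, as (S1ᵀ) grants).  Suppose the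
tuple's residual obeys 12b's locality law, has the Gaussian placeholders `quad_j(∅) = 0`, and is PINNED at generation `k` on `T` by def-T's level-`k` resummed
step weight on the scale-`k` averaging graph: `ζ0_k(T)(V_k, V_{k+1}) = w_k(s′)(V_k, V̄_k)` — a function of the scale-`k` variables only.  Then, under unity of
def-T's residual `ζ` (`0 ≤ w_k(s′) ≤ 1`) and the displayed measurability ∕ bound of the old branch `U ↦ 𝐓_k(init s′,∅)e^{A_k(init s′)}(U)` and joint measurability
of `w_k(s′)`, the dichotomy clause of `HasSect2FormTAEZ … k (UbgOfRecord₁₃CoP θ p (k+1)) slotT` AT `s′` holds for EVERY term-value witness `t′`, with the constant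
`E_{k+1}(s′) := E_k(init s′)` of `SLaw`'s witness: EITHER `slotT_{k+1}(s′) ≡ 0` (when `ρ_k`'s slot at `init s′` is absent) OR `slotT_{k+1}(s′) = 𝐓_{k+1}(s′)e^{A_{k+1}(s′)}`
`dV′`-a.e.  [cite: Balaban1988Convergent, Theorem p.245, (3.24)–(3.25) p.270, (2.18) p.257, (2.20)–(2.23) p.258, (3.16) p.268, (1.11) p.248] -/
theorem hasSect2FormAtZ_clause_succ_CoP_of_allLarge_pin {k : ℕ} (hk : k < p.K) (hM : 1 ≤ θ.τ9.M) (hζu : IsZetaUnity F N θ.ν θ.τ9.M θ.ζ)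
    (hloc : (θ.Zt p.K).LocalLaws) (hq : ∀ (j : ℕ) (ω : MultiCfg (F.P p.K) (SU N) (FluctV N)), (θ.Zt p.K).quad j ∅ ω = 0)
    (hS : SLaw₁₃CoP F N θ p k)
    (s : SeqOfRecord F θ.ν θ.τ9.M (gOfRecord₁₃ F N θ p) p.K (k + 1)) (hall : ∀ j, 1 ≤ j → j ≤ k + 1 → s.Ω j = ∅)
    (hZ : ∀ (V' : GaugeField (F.P p.K) (k + 1) (SU N)) (U₀ : GaugeField (F.P p.K) k (SU N)),
      (θ.Zt p.K).ζ0 k Set.univ (pairCfgAt (V := FluctV N) k V' U₀) =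
        wOfRecord₉ F N θ.toStage9Params p (gOfRecord₁₃ F N θ p) k s U₀ ((avOfRecord F N p.K k).avg U₀))
    (hmw : Measurable fun z : GaugeField (F.P p.K) (k + 1) (SU N) × GaugeField (F.P p.K) k (SU N) =>
      wOfRecord₉ F N θ.toStage9Params p (gOfRecord₁₃ F N θ p) k s z.2 z.1)
    {C : ℝ}
    (hmB : ∀ (t : Sect2.TermValues (F.P p.K) (MatA N) (FluctV N) θ.τ9.M) (Ek : ℝ),
      Measurable fun U₀ : GaugeField (F.P p.K) k (SU N) =>
        tkBranchOfRecord F N (FluctV N) θ.ν θ.τ9.M _ p.K (WtOfRecord₁₃P F N θ p) s.init (fun _ => ∅) k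
          (fun ω => sect2Operand F N (FluctV N) p.K (settingOfRecord₁₃ F N θ p) (θ.Rz p.K) s.init t Ek (UbgOfRecord₁₃CoP F N θ p k s.init)
            ((fun _ => ∅ : ℕ → Set (Site (F.P p.K) 0)), fun j => (ω j).2) (fun j => (ω j).1))
          (baseCfg (V := FluctV N) k U₀))
    (hCB : ∀ (t : Sect2.TermValues (F.P p.K) (MatA N) (FluctV N) θ.τ9.M) (Ek : ℝ) (U₀ : GaugeField (F.P p.K) k (SU N)),
      |tkBranchOfRecord F N (FluctV N) θ.ν θ.τ9.M _ p.K (WtOfRecord₁₃P F N θ p) s.init (fun _ => ∅) k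
          (fun ω => sect2Operand F N (FluctV N) p.K (settingOfRecord₁₃ F N θ p) (θ.Rz p.K) s.init t Ek (UbgOfRecord₁₃CoP F N θ p k s.init)
            ((fun _ => ∅ : ℕ → Set (Site (F.P p.K) 0)), fun j => (ω j).2) (fun j => (ω j).1))
          (baseCfg (V := FluctV N) k U₀)| ≤ C)
    (t' : Sect2.TermValues (F.P p.K) (MatA N) (FluctV N) θ.τ9.M) :
    ∃ Ek' : ℝ,
      slotsTOfRecord F N θ.ν θ.τ9 (EOfRecord₁₃ F N θ) (wOfRecord₉ F N θ.toStage9Params) θ.ppSel p (gOfRecord₁₃ F N θ p) (k + 1) s = 0 ∨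
        ∀ᵐ V' ∂fieldMeasure (F.P p.K) (k + 1) (SU N),
          chiSeqOfRecord F N θ.ν θ.τ9.M (gOfRecord₁₃ F N θ p) p.K (k + 1) s V' ≠ 0 →
            slotsTOfRecord F N θ.ν θ.τ9 (EOfRecord₁₃ F N θ) (wOfRecord₉ F N θ.toStage9Params) θ.ppSel p
                (gOfRecord₁₃ F N θ p) (k + 1) s V' =
              sect2Slot F N (FluctV N) p.K (settingOfRecord₁₃ F N θ p) (θ.Rz p.K) (WtOfRecord₁₃P F N θ p) s t' Ek'
                (UbgOfRecord₁₃CoP F N θ p (k + 1) s) V' := by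
  classical
  obtain ⟨t, Ek, -, hs⟩ := (sLaw₁₃CoP_iff F N θ p k).mp hS
  refine ⟨Ek s.init, ?_⟩
  have hinit := init_allLarge θ p s hall
  have hΩtop : s.Ω (k + 1) = ∅ := hall (k + 1) (by omega) le_rfl
  -- `χ_k(init s′) ≡ 1`: no front factor along the history
  have hχ : ∀ U₀ : GaugeField (F.P p.K) k (SU N), chiSeqOfRecord F N θ.ν θ.τ9.M (gOfRecord₁₃ F N θ p) p.K k s.init U₀ = 1 := by
    intro U₀
    rcases Nat.eq_zero_or_pos k with hk0 | hkpos
    · subst hk0; exact chiSeqOfRecord_zero F N θ.ν θ.τ9.M _ p.K s.init U₀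
    · exact chiSeqOfRecord_eq_one_of_Omega_empty F N θ.ν θ.τ9.M _ p.K k s.init (hinit k hkpos le_rfl) U₀
  rcases (hs s.init).2 with h0 | hid
  · -- absent slot at `init s′` ⇒ absent pre-𝐑 slot at `s′`
    refine Or.inl ?_
    funext V'
    rw [slotsTOfRecord_succ_apply, h0]
    show transportOfRecord F N p.K k (fun U => _ * (_ * (0 : ℝ))) V' = 0
    simp only [mul_zero]
    show T4AveragingDisintegration.kernelTransport _ _ _ (fun _ => (0 : ℝ)) V' = 0
    simp only [T4AveragingDisintegration.kernelTransport, integral_zero, mul_zero]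
  · refine Or.inr ?_
    -- the old index is `{∅}`: every hypothesis per old branch is one statement about the all-empty branch
    have hA := admSOfRecord_init_eq_of_allLarge θ p s hall
    -- the new integrand of the all-empty branch, closed form: `w_k(s′)(U₀, Ū₀) · e^{E_k − E_{k+1}} · B(U₀)` with `E_{k+1} = E_k`
    have hold := oldFactors_agree_CoP_of_allLarge θ p hM hloc hq s hall (t s.init) t' (Ek s.init) (Ek s.init)
    have hfac : ∀ (V' : GaugeField (F.P p.K) (k + 1) (SU N)) (U₀ : GaugeField (F.P p.K) k (SU N)),
        (WtOfRecord₁₃P F N θ p).ζ k Set.univ (pairCfgAt (V := FluctV N) k V' U₀) * (WtOfRecord₁₃P F N θ p).w k ∅ ∅ ∅ (pairCfgAt (V := FluctV N) k V' U₀) =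
          wOfRecord₉ F N θ.toStage9Params p (gOfRecord₁₃ F N θ p) k s U₀ ((avOfRecord F N p.K k).avg U₀) := by
      intro V' U₀
      rw [WtOfRecord₁₃P_w_empty_eq_one θ p hq, mul_one]
      exact (hZ V' U₀)
    have hint : ∀ (V' : GaugeField (F.P p.K) (k + 1) (SU N)) (U₀ : GaugeField (F.P p.K) k (SU N)),
        noExpIntegrandAt F N (FluctV N) p.K k (WtOfRecord₁₃P F N θ p)
            (tkBranchOfRecord F N (FluctV N) θ.ν θ.τ9.M _ p.K (WtOfRecord₁₃P F N θ p) s.init (fun _ => ∅) k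
              (fun ω => sect2Operand F N (FluctV N) p.K (settingOfRecord₁₃ F N θ p) (θ.Rz p.K) s t' (Ek s.init) (UbgOfRecord₁₃CoP F N θ p (k + 1) s)
                ((fun _ => ∅ : ℕ → Set (Site (F.P p.K) 0)), fun j => (ω j).2) (fun j => (ω j).1)))
            V' U₀ =
          wOfRecord₉ F N θ.toStage9Params p (gOfRecord₁₃ F N θ p) k s U₀ ((avOfRecord F N p.K k).avg U₀) *
            tkBranchOfRecord F N (FluctV N) θ.ν θ.τ9.M _ p.K (WtOfRecord₁₃P F N θ p) s.init (fun _ => ∅) k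
              (fun ω => sect2Operand F N (FluctV N) p.K (settingOfRecord₁₃ F N θ p) (θ.Rz p.K) s.init (t s.init) (Ek s.init)
                (UbgOfRecord₁₃CoP F N θ p k s.init) ((fun _ => ∅ : ℕ → Set (Site (F.P p.K) 0)), fun j => (ω j).2) (fun j => (ω j).1))
              (baseCfg (V := FluctV N) k U₀) := by
      intro V' U₀
      rw [noExpIntegrandAt_eq_zetaFactor_mul, hfac, hold V' U₀, sub_self, Real.exp_zero, one_mul]
    -- measurability ∕ bound of the new integrand (displayed data on `w_k(s′)` and on the old branch)
    have hw0 : ∀ U₀ : GaugeField (F.P p.K) k (SU N), 0 ≤ wOfRecord₉ F N θ.toStage9Params p (gOfRecord₁₃ F N θ p) k s U₀ ((avOfRecord F N p.K k).avg U₀) :=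
      fun U₀ => wOfRecord_nonneg_of_Omega_empty F N θ.ν θ.τ9.M θ.A₁ p (gOfRecord₁₃ F N θ p) k hζu s hΩtop U₀ _
    have hw1 : ∀ U₀ : GaugeField (F.P p.K) k (SU N), wOfRecord₉ F N θ.toStage9Params p (gOfRecord₁₃ F N θ p) k s U₀ ((avOfRecord F N p.K k).avg U₀) ≤ 1 :=
      fun U₀ => wOfRecord_le_one_of_Omega_empty F N θ.ν θ.τ9.M θ.A₁ p (gOfRecord₁₃ F N θ p) k hζu s hΩtop U₀ _
    have hg : Measurable fun U₀ : GaugeField (F.P p.K) k (SU N) =>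
        ((((avOfRecord F N p.K k).avg U₀), U₀) : GaugeField (F.P p.K) (k + 1) (SU N) × GaugeField (F.P p.K) k (SU N)) :=
      (avOfRecord_measurable F N p.K k).prodMk measurable_id
    have hgraph : Measurable fun U₀ : GaugeField (F.P p.K) k (SU N) =>
        wOfRecord₉ F N θ.toStage9Params p (gOfRecord₁₃ F N θ p) k s U₀ ((avOfRecord F N p.K k).avg U₀) := by
      simpa only [Function.comp_def] using hmw.comp hg
    refine slotsT_succ_ae_eq_sect2Slot_of_zetaSpecAt θ p hk s hΩtop (WtOfRecord₁₃P F N θ p) (t s.init) (Ek s.init)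
      (UbgOfRecord₁₃CoP F N θ p k s.init) hid hχ t' (Ek s.init) (UbgOfRecord₁₃CoP F N θ p (k + 1) s) (κ := 1) (c := 1) (C := C) (one_mul 1)
      ?_ ?_ ?_ ?_
    · -- old-factor agreement on the old index `{∅}`
      intro S hS V' U₀
      rw [hA, Finset.mem_singleton] at hS
      subst hS
      rw [hold V' U₀, sub_self, Real.exp_zero]
    · -- the generation-`k` spec with `c = 1`
      intro U₀
      rw [hfac, one_mul]
    · -- measurability of the new integrand per old branch
      intro S hS
      rw [hA, Finset.mem_singleton] at hS
      subst hS
      have hfun : Function.uncurry (noExpIntegrandAt F N (FluctV N) p.K k (WtOfRecord₁₃P F N θ p)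
          (tkBranchOfRecord F N (FluctV N) θ.ν θ.τ9.M _ p.K (WtOfRecord₁₃P F N θ p) s.init (fun _ => ∅) k
            (fun ω => sect2Operand F N (FluctV N) p.K (settingOfRecord₁₃ F N θ p) (θ.Rz p.K) s t' (Ek s.init) (UbgOfRecord₁₃CoP F N θ p (k + 1) s)
              ((fun _ => ∅ : ℕ → Set (Site (F.P p.K) 0)), fun j => (ω j).2) (fun j => (ω j).1)))) =
          fun z => wOfRecord₉ F N θ.toStage9Params p (gOfRecord₁₃ F N θ p) k s z.2 ((avOfRecord F N p.K k).avg z.2) *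
            tkBranchOfRecord F N (FluctV N) θ.ν θ.τ9.M _ p.K (WtOfRecord₁₃P F N θ p) s.init (fun _ => ∅) k
              (fun ω => sect2Operand F N (FluctV N) p.K (settingOfRecord₁₃ F N θ p) (θ.Rz p.K) s.init (t s.init) (Ek s.init)
                (UbgOfRecord₁₃CoP F N θ p k s.init) ((fun _ => ∅ : ℕ → Set (Site (F.P p.K) 0)), fun j => (ω j).2) (fun j => (ω j).1))
              (baseCfg (V := FluctV N) k z.2) := by
        funext z
        rcases z with ⟨V', U₀⟩
        exact hint V' U₀
      rw [hfun]
      exact (hgraph.comp measurable_snd).mul ((hmB (t s.init) (Ek s.init)).comp measurable_snd)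
    · -- bound of the new integrand per old branch: `|w·B| ≤ C`
      intro S hS V' U₀
      rw [hA, Finset.mem_singleton] at hS
      subst hS
      rw [hint V' U₀, abs_mul, abs_of_nonneg (hw0 U₀)]
      have hC0 : 0 ≤ C := (abs_nonneg _).trans (hCB (t s.init) (Ek s.init) U₀)
      calc wOfRecord₉ F N θ.toStage9Params p (gOfRecord₁₃ F N θ p) k s U₀ ((avOfRecord F N p.K k).avg U₀) * _
          ≤ 1 * C := mul_le_mul (hw1 U₀) (hCB (t s.init) (Ek s.init) U₀) (abs_nonneg _) zero_le_one
        _ = C := one_mul C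

end Main

end Summit.QuantumFields.YangMills.Theorems.BalabanUVNodesN11NoExpansionAllLargeCoP

end
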